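import Literature.NumberTheory.Automorphic.RankinSelbergTwistedQuotientUnfolding
import Literature.NumberTheory.Automorphic.RankinSelbergIntegralTwistedEntire
import Literature.NumberTheory.Automorphic.MirabolicEisensteinRealPoint
import Literature.NumberTheory.Automorphic.RankinSelbergUnfoldingPairs
import Literature.NumberTheory.Automorphic.SmoothedFormCentralCharacter
import Literature.NumberTheory.Automorphic.SmoothedCuspFormGeneric
import Literature.NumberTheory.Automorphic.RatPointsCoveringWeights
import HarnessLib

/-!
# The unfolding of the twisted Rankin–Selberg integral of a pair at a real point:
# `I(σ; φ̄', φ, Φ, η) = C · Ψ(σ; W_φ, W̄_{φ'}, Φ)` for cusp forms with `ω_π ω_σ⁻¹ = η`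

Topic `NumberTheory/Automorphic`; namespace `Literature.NumberTheory.Automorphic`. Proof file (theorems
only). The **basic identity of the Rankin–Selberg method for a pair of cusp forms whose central
characters need not agree** (J. W. Cogdell, *Analytic theory of `L`-functions for `GL_n`*, §2.3, Thm.
2.1, with the Eisenstein series twisted by the product of the central characters, p. 211; Jacquet–Shalika
(1981), §4, (4.4)–(4.6)) at a REAL point `σ > 1`: for cuspidal `π ∋ f`, `π' ∋ f'` on `GL_n(𝔸_K)` with
central characters `ω`, `ω'`, smoothed forms `φ̃ = S_θ f`, `φ̃' = S_θ f'` in the honest `L²` model, a real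
Schwartz–Bruhat `Φ ≥ 0`, and `η = ω ω'⁻¹` (unitary, trivial on `A_G`),

  `∫_X φ̄̃'(x) φ̃(x) E_X(x, Φ; σ, η) dμ'(x) = C · Ψ(σ; W_φ, W̄_{φ'}, Φ)`,

the left side the twisted Rankin–Selberg integral `rankinSelbergIntegralTwisted` against the descended
twisted mirabolic Eisenstein series (`RankinSelbergIntegralTwistedEntire`, `MirabolicEisensteinSeriesTwisted`),
the right side the torus pair integral of `RankinSelbergUnfoldingPairs` for `φ = invQuot φ̃`,
`φ' = invQuot φ̃'` and their Whittaker coefficients, `C > 0` depending only on the Haar measures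
(`exists_rankinSelbergIntegralTwisted_ofReal_eq_mul_rankinSelbergTorusPairIntegral`, **main**). This is
the pairs companion of `RankinSelbergUnfoldingRealPointPairs` without the hypothesis of a common central
action — a brick of the inline decomposition of `MoeglinWaldspurger1989_partialPairL_entire_of_ne_conj`
(Mœglin–Waldspurger (1989), Appendice, Cor. (i)(b)) for the pairs with `ω_π ω̄_σ ≠ 1`.

Assembly of landed bricks: the real-point bridge `E(y, Φ; σ, η) = ∫_𝓕 w_{Φ,σ}((a 1_n) y) η(a) dν_I`
(`mirabolicEisensteinTwisted_ofReal_eq_setIntegral_eisensteinWeight`, from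
`mirabolicEisensteinTwisted_one_eq_setIntegral_thetaStar`), the twisted quotient unfolding
`∫_X E^η_X F dμ' = C₁ ∫_G w β_G F(π g⁻¹) dν` for `F = φ̄̃' φ̃` of central character `η⁻¹`
(`RankinSelbergTwistedQuotientUnfolding`, with the central characters of `S_θ f`, `S_θ f'`,
`SmoothedFormCentralCharacter`), and the group-side pair identity by polarization and Whittaker–Parseval
`C₃ Ψ(σ; W_φ, W̄_{φ'}, Φ) = ∫_G φ φ̄' w_{Φ,σ} β_G dν` (`RankinSelbergUnfoldingPairs`).

## References

* J. W. Cogdell, *Analytic theory of L-functions for GL_n*, in *An Introduction to the Langlands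
  Program* (2004), §2.3 Thm. 2.1, p. 211 [CogdellAnalyticTheory2004].
* H. Jacquet, J. A. Shalika, *On Euler products and the classification of automorphic
  representations I*, Amer. J. Math. 103 (1981), §4, (4.4)–(4.6) [JacquetShalikaAJM1981].
-/

noncomputable section

open MeasureTheory Measure Set Filter Topology IsDedekindDomain NumberField Matrix
open scoped ENNReal NNReal ComplexConjugate

namespace Literature.NumberTheory.Automorphic

open Literature.NumberTheory.GaloisRepresentations (ideleGroup HeckeCharacter)
open Literature.MeasureTheory.Group (coveringSum IsCoveringWeight wt)

-- the automorphic quotient carries the tree's Borel σ-algebra, not Mathlib's quotient σ-algebra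
attribute [-instance] Quotient.instMeasurableSpace QuotientGroup.measurableSpace

/-! ### The twisted Eisenstein series at a real point as an idele-class integral of the weight -/

section RealPoint

variable {n : ℕ} {K : Type} [Field K] [NumberField K]
variable [MeasurableSpace (AdeleRing (𝓞 K) K)] [BorelSpace (AdeleRing (𝓞 K) K)]

attribute [local instance] borelSpace_ideleGroup

variable (ν : Measure (ideleGroup K)) [ν.IsHaarMeasure]

/-- **The twisted mirabolic Eisenstein series at a real point is the `η`-weighted idele-class integral of
the Eisenstein weight.** For a real `Φ ≥ 0` with `Φ ∈ 𝒮(𝔸_Kⁿ)`, a unitary `η`, a real `σ > 1`, an idele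
class domain `𝓕` and `y ∈ GL_n(𝔸_K)`:
`∫_𝓕 w_{Φ,σ}((a 1_n) y) dν(a) < ∞` and `E(y, Φ; σ, η) = ∫_𝓕 w_{Φ,σ}((a 1_n) y) η(a) dν(a)`
(`mirabolicEisensteinTwisted_one_eq_setIntegral_thetaStar`; Jacquet–Shalika (1981), §4, (4.2)–(4.3);
Cogdell (2004), §2.3). [cite: JacquetShalikaAJM1981, §4] -/
theorem mirabolicEisensteinTwisted_ofReal_eq_setIntegral_eisensteinWeight {𝓕 : Set (ideleGroup K)}
    (h𝓕 : IsIdeleClassDomain K 𝓕) {η : HeckeCharacter K} (hu : η.IsUnitary) {Φ : (Fin n → AdeleRing (𝓞 K) K) → ℝ}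
    (hΦ : (fun x => (Φ x : ℂ)) ∈ piSchwartzBruhat K (Fin n)) (hΦ0 : ∀ x, 0 ≤ Φ x) {σ : ℝ} (hσ : 1 < σ)
    (y : GL (Fin n) (AdeleRing (𝓞 K) K)) :
    (∫⁻ a in 𝓕, eisensteinWeight n K Φ σ (Matrix.GeneralLinearGroup.scalar (Fin n) a * y) ∂ν) < ⊤ ∧
      mirabolicEisensteinTwisted K ν η (fun x => (Φ x : ℂ)) (σ : ℂ) y =
        ∫ a in 𝓕, (((eisensteinWeight n K Φ σ (Matrix.GeneralLinearGroup.scalar (Fin n) a * y)).toReal : ℝ) : ℂ) *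
          ((η a : ℂˣ) : ℂ) ∂ν := by
  refine ⟨(mirabolicEisenstein_ofReal_eq_toReal_setLIntegral_eisensteinWeight ν h𝓕 hΦ hΦ0 hσ y).1, ?_⟩
  -- the translated Schwartz–Bruhat function `Ψ = Φ(· y)` and the real series `T(a) = ∑_{v ≠ 0} Φ((a v) y)`
  set Ψ : (Fin n → AdeleRing (𝓞 K) K) → ℂ :=
    fun x => (Φ (x ᵥ* (y : Matrix (Fin n) (Fin n) (AdeleRing (𝓞 K) K))) : ℂ) with hΨ
  have hΨS : Ψ ∈ piSchwartzBruhat K (Fin n) := comp_vecMul_mem_piSchwartzBruhat hΦ y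
  set T : ideleGroup K → ℝ := fun a => ∑' v : (({0} : Set (Fin n → K))ᶜ : Set (Fin n → K)),
    Φ (((a : AdeleRing (𝓞 K) K) • ratVec K (v : Fin n → K)) ᵥ* (y : Matrix (Fin n) (Fin n) (AdeleRing (𝓞 K) K)))
    with hT
  set q : ℝ := (IdeleClassGroup.ideleNorm K (Matrix.GeneralLinearGroup.det y) : ℝ) with hq
  have hq0 : 0 ≤ q := NNReal.coe_nonneg _
  have hterm0 : ∀ (a : ideleGroup K) (v : Fin n → K),
      0 ≤ Φ (((a : AdeleRing (𝓞 K) K) • ratVec K v) ᵥ* (y : Matrix (Fin n) (Fin n) (AdeleRing (𝓞 K) K))) :=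
    fun a v => hΦ0 _
  have hsum : ∀ a : ideleGroup K, Summable fun v : (({0} : Set (Fin n → K))ᶜ : Set (Fin n → K)) =>
      Φ (((a : AdeleRing (𝓞 K) K) • ratVec K (v : Fin n → K)) ᵥ* (y : Matrix (Fin n) (Fin n) (AdeleRing (𝓞 K) K))) := by
    intro a
    have h := (summable_norm_theta_term hΨS a).subtype (({0} : Set (Fin n → K))ᶜ : Set (Fin n → K))
    refine h.congr fun v => ?_
    simp only [Function.comp_apply, hΨ, Complex.norm_real, Real.norm_of_nonneg (hterm0 a v)]
  have hT0 : ∀ a, 0 ≤ T a := fun a => tsum_nonneg fun v => hterm0 a v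
  -- `Θ*_Ψ(a) = T(a)` as a complex number
  have hθ : ∀ a : ideleGroup K, thetaStar K Ψ a = (T a : ℂ) := by
    intro a
    rw [hT]
    simp only []
    rw [Complex.ofReal_tsum]
    rfl
  have hTenn : ∀ a : ideleGroup K, (∑' v : {v : Fin n → K // v ≠ 0},
      ENNReal.ofReal (Φ (((a : AdeleRing (𝓞 K) K) • ratVec K v.1) ᵥ*
        (y : Matrix (Fin n) (Fin n) (AdeleRing (𝓞 K) K))))) = ENNReal.ofReal (T a) := by
    intro a
    rw [hT]
    simp only []
    rw [ENNReal.ofReal_tsum_of_nonneg (fun v => hterm0 a _) (hsum a)]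
    rfl
  -- the Eisenstein weight along `(a 1_n) y`, as a real number
  have hpow : ∀ a : ideleGroup K, ((IdeleClassGroup.ideleNorm K a : ℝ) ^ n * q) ^ σ =
      (IdeleClassGroup.ideleNorm K a : ℝ) ^ ((n : ℝ) * σ) * q ^ σ := fun a => by
    rw [Real.mul_rpow (pow_nonneg (NNReal.coe_nonneg _) _) hq0, ← Real.rpow_natCast,
      ← Real.rpow_mul (NNReal.coe_nonneg _)]
  have hEW : ∀ a : ideleGroup K, (eisensteinWeight n K Φ σ (Matrix.GeneralLinearGroup.scalar (Fin n) a * y)).toReal =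
      T a * (IdeleClassGroup.ideleNorm K a : ℝ) ^ ((n : ℝ) * σ) * q ^ σ := by
    intro a
    rw [eisensteinWeight_scalar_mul hΦ0, hTenn, hpow,
      ENNReal.ofReal_mul (Real.rpow_nonneg (NNReal.coe_nonneg _) _), ← mul_assoc, ← ENNReal.ofReal_mul (hT0 a),
      ENNReal.toReal_mul, ENNReal.toReal_ofReal (mul_nonneg (hT0 a) (Real.rpow_nonneg (NNReal.coe_nonneg _) _)),
      ENNReal.toReal_ofReal (Real.rpow_nonneg hq0 _)]
  -- `E(1, Ψ; σ, η)` as the weighted idele-class integral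
  have hσ' : 1 < ((σ : ℂ)).re := by rwa [Complex.ofReal_re]
  have hE1 : mirabolicEisensteinTwisted K ν η Ψ (σ : ℂ) 1 =
      ∫ a in 𝓕, ((T a * (IdeleClassGroup.ideleNorm K a : ℝ) ^ ((n : ℝ) * σ) : ℝ) : ℂ) * ((η a : ℂˣ) : ℂ) ∂ν := by
    rw [mirabolicEisensteinTwisted_one_eq_setIntegral_thetaStar ν h𝓕 hu hΨS hσ']
    refine integral_congr_ae (ae_of_all _ fun a => ?_)
    dsimp only
    rw [hθ a, ← Complex.ofReal_natCast, ← Complex.ofReal_mul, ← Complex.ofReal_cpow (NNReal.coe_nonneg _),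
      ← Complex.ofReal_mul]
  rw [mirabolicEisensteinTwisted_eq_cpow_mul_mirabolicEisensteinTwisted_one ν η _ (σ : ℂ) y, hE1, ← hq,
    ← Complex.ofReal_cpow hq0, ← integral_const_mul]
  refine integral_congr_ae (ae_of_all _ fun a => ?_)
  dsimp only
  rw [hEW a]
  push_cast
  ring

end RealPoint

/-! ### The twisted Rankin–Selberg integral of a pair at a real point -/

section Pairs

variable {n : ℕ} {K : Type} [Field K] [NumberField K]
variable [MeasurableSpace (AdeleRing (𝓞 K) K)] [BorelSpace (AdeleRing (𝓞 K) K)]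

-- the house local instances: Borel structures of `GL_n(𝔸_K)` in both spellings and of `𝔸_Kˣ`; the
-- quotient instances of `GLnAutomorphicUnfolding`; none overrides a Mathlib instance
attribute [local instance] adelicBorel borelSpace_adelic locallyCompactSpace_adelic secondCountableTopology_gl_adelic
  glAdeleBorel borelSpace_glAdele borelSpace_ideleGroup

/-- The descended twisted Eisenstein series `E_X(·, Φ; s, η)` is continuous for `Φ ∈ 𝒮(𝔸_Kⁿ)`, unitary
`η` and `re s > 1` (`continuous_mirabolicEisensteinTwisted_of_mem_piSchwartzBruhat` and the quotient map).
[folklore] -/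
theorem continuous_mirabolicEisensteinTwistedQuot_of_mem_piSchwartzBruhat
    (ν : Measure (ideleGroup K)) [ν.IsHaarMeasure] [ν.IsMulRightInvariant]
    {η : HeckeCharacter K} (hu : η.IsUnitary) (hη₀ : ∀ t : ℝ≥0ˣ, η (posRealIdele K t) = 1)
    {Φ : (Fin n → AdeleRing (𝓞 K) K) → ℂ} (hΦ : Φ ∈ piSchwartzBruhat K (Fin n)) {s : ℂ} (hs : 1 < s.re) :
    Continuous (mirabolicEisensteinTwistedQuot (K := K) ν hη₀ Φ s) := by
  have h : Continuous fun x : GL (Fin n) (AdeleRing (𝓞 K) K) =>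
      mirabolicEisensteinTwisted K ν η Φ s (x⁻¹ : GL (Fin n) (AdeleRing (𝓞 K) K)) :=
    (continuous_mirabolicEisensteinTwisted_of_mem_piSchwartzBruhat K ν hu hΦ hs).comp continuous_inv
  exact h.quotient_lift _

/-- **The twisted Rankin–Selberg integral of a pair at a real point unfolds to the torus pair integral.**
There is a constant `C > 0`, depending only on the Haar measures, such that for all cuspidal automorphic
representations `π, π'` of `GL_n(𝔸_K)` (`0 < n`) with central characters `ω, ω'` (the scalars `z 1_n`
acting on the smoothed forms of `π`, `π'` through `ω(z)⁻¹`, `ω'(z)⁻¹`, `SmoothedFormCentralCharacter`), all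
`f ∈ π`, `f' ∈ π'`, every continuous compactly supported weight `θ`, every real `Φ ≥ 0` with
`Φ ∈ 𝒮(𝔸_Kⁿ)` and `g ↦ Φ(e_n g)` measurable, every real `σ > 1` at which the two unfolded integrals
`Ψ(σ; W_φ, W̄_φ, Φ)`, `Ψ(σ; W_{φ'}, W̄_{φ'}, Φ)` are finite, and `η = ω ω'⁻¹`:

  `rankinSelbergIntegralTwisted μ' ν_I hη₀ Φ σ (star (S_θ f')) (S_θ f)
     = C · rankinSelbergTorusPairIntegral νA νK W_φ (star W_{φ'}) Φ σ`,

`φ = invQuot (S_θ f)`, `φ' = invQuot (S_θ f')`, `W_ψ = whittakerCoeff ν₀ 𝓕_N ψ_𝔸 ψ` — Cogdell's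
`I(s; φ, φ', Φ) = Ψ(s; W_φ, W'_{φ'}, Φ)` (Thm. 2.1) for the pair `(S_θ f, S̄_θ f')`, the Eisenstein series
twisted by `η = ω ω'⁻¹` so that `φ̄̃' φ̃ E(·; s, η)` lives on the quotient (§2.3, p. 211).
[cite: CogdellAnalyticTheory2004, §2.3 Thm. 2.1] [cite: JacquetShalikaAJM1981, §4] -/
theorem exists_rankinSelbergIntegralTwisted_ofReal_eq_mul_rankinSelbergTorusPairIntegral (hn : 0 < n)
    (μ' : Measure (AdelicGroupData.gl n K).automorphicQuotient) [(AdelicGroupData.gl n K).IsAutomorphicMeasure μ']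
    (νI : Measure (ideleGroup K)) [νI.IsHaarMeasure]
    (νA : Measure (Fin n → ideleGroup K)) [IsHaarMeasure νA]
    (νK : Measure ↥(maximalCompactAdelic n K)) [IsHaarMeasure νK]
    (ν₀ : Measure ↥(adelicUnipotent n K)) [IsHaarMeasure ν₀] :
    ∃ C : ℝ, 0 < C ∧
      ∀ (P P' : CuspidalAutomorphicRepGL n K μ') (f : P.1.toSubmodule) (f' : P'.1.toSubmodule)
        {ω ω' η : HeckeCharacter K}, ω.IsUnitary → ω'.IsUnitary → η = ω * ω'⁻¹ →
      ∀ (hη₀ : ∀ t : ℝ≥0ˣ, η (posRealIdele K t) = 1)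
        {θ : (AdelicGroupData.gl n K).Adelic → ℝ}, Continuous θ → HasCompactSupport θ →
        (∀ (z : ideleGroup K) (g : GL (Fin n) (AdeleRing (𝓞 K) K)),
          smoothedForm θ (f : (AdelicGroupData.gl n K).L2 μ')
              ((AdelicGroupData.gl n K).toAutomorphicQuotient (Matrix.GeneralLinearGroup.scalar (Fin n) z * g)) =
            ((ω z : ℂˣ) : ℂ)⁻¹ * smoothedForm θ (f : (AdelicGroupData.gl n K).L2 μ')
              ((AdelicGroupData.gl n K).toAutomorphicQuotient g)) →
        (∀ (z : ideleGroup K) (g : GL (Fin n) (AdeleRing (𝓞 K) K)),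
          smoothedForm θ (f' : (AdelicGroupData.gl n K).L2 μ')
              ((AdelicGroupData.gl n K).toAutomorphicQuotient (Matrix.GeneralLinearGroup.scalar (Fin n) z * g)) =
            ((ω' z : ℂˣ) : ℂ)⁻¹ * smoothedForm θ (f' : (AdelicGroupData.gl n K).L2 μ')
              ((AdelicGroupData.gl n K).toAutomorphicQuotient g)) →
      ∀ {Φ : (Fin n → AdeleRing (𝓞 K) K) → ℝ}, (fun x => (Φ x : ℂ)) ∈ piSchwartzBruhat K (Fin n) →
        (∀ x, 0 ≤ Φ x) → (Measurable fun g : GL (Fin n) (AdeleRing (𝓞 K) K) => Φ (lastRow n K g)) →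
      ∀ {σ : ℝ}, 1 < σ →
        rankinSelbergTorusIntegral n K νA νK (whittakerCoeff ν₀ (unipotentTateDomain n K) (adeleAddChar K)
          (invQuot (AdelicGroupData.gl n K) (smoothedForm θ (f : (AdelicGroupData.gl n K).L2 μ')))) Φ σ ≠ ⊤ →
        rankinSelbergTorusIntegral n K νA νK (whittakerCoeff ν₀ (unipotentTateDomain n K) (adeleAddChar K)
          (invQuot (AdelicGroupData.gl n K) (smoothedForm θ (f' : (AdelicGroupData.gl n K).L2 μ')))) Φ σ ≠ ⊤ →
        rankinSelbergIntegralTwisted μ' νI hη₀ (fun x => (Φ x : ℂ)) (σ : ℂ)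
            (star (smoothedForm θ (f' : (AdelicGroupData.gl n K).L2 μ')))
            (smoothedForm θ (f : (AdelicGroupData.gl n K).L2 μ')) =
          (C : ℂ) * rankinSelbergTorusPairIntegral n K νA νK
            (whittakerCoeff ν₀ (unipotentTateDomain n K) (adeleAddChar K)
              (invQuot (AdelicGroupData.gl n K) (smoothedForm θ (f : (AdelicGroupData.gl n K).L2 μ'))))
            (star (whittakerCoeff ν₀ (unipotentTateDomain n K) (adeleAddChar K)
              (invQuot (AdelicGroupData.gl n K) (smoothedForm θ (f' : (AdelicGroupData.gl n K).L2 μ'))))) Φ σ := by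
  classical
  haveI : T2Space (GL (Fin n) (AdeleRing (𝓞 K) K)) := t2Space_gl n K
  haveI : LocallyCompactSpace (GL (Fin n) (AdeleRing (𝓞 K) K)) :=
    AdelicGroupData.locallyCompactSpace_generalLinearGroup_adeleRing K (Fin n)
  haveI : SecondCountableTopology (GL (Fin n) (AdeleRing (𝓞 K) K)) :=
    secondCountableTopology_generalLinearGroup_adeleRing K (Fin n)
  -- a Haar measure on `GL_n(𝔸_K)` and the two unfolding constants
  set ν : Measure (GL (Fin n) (AdeleRing (𝓞 K) K)) := Measure.haar with hν
  haveI hνGL : IsHaarMeasure ν := by rw [hν]; infer_instance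
  haveI hνgl : (show Measure (AdelicGroupData.gl n K).Adelic from ν).IsHaarMeasure := hνGL
  obtain ⟨C₁, hC₁0, h5⟩ := exists_integral_eisensteinTwisted_mul_eq (n := n) (K := K) hn μ'
    (show Measure (AdelicGroupData.gl n K).Adelic from ν) νI
  obtain ⟨C₃, hC₃0, hC₃t, hone, hpair⟩ :=
    exists_mul_rankinSelbergTorusPairIntegral_eq_integral_eisensteinWeight (n := n) (K := K) hn ν νA νK ν₀
  -- an idele class domain and a `GL_n(K)`-covering weight
  obtain ⟨𝓕, h𝓕⟩ := exists_isIdeleClassDomain K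
  obtain ⟨βG, hβG⟩ := exists_isCoveringWeight_ratPoints (n := n) (K := K) (⊤ : Subgroup (GL (Fin n) K))
  have hC₃r : 0 < C₃.toReal := ENNReal.toReal_pos hC₃0 hC₃t
  refine ⟨C₁ * C₃.toReal, mul_pos hC₁0 hC₃r,
    fun P P' f f' {ω ω' η} hωu hω'u hηeq hη₀ {θ} hθ hθs hωf hω'f' {Φ} hΦS hΦ0 hΦm {σ} hσ hfin hfin' => ?_⟩
  -- the data
  set φt : (AdelicGroupData.gl n K).automorphicQuotient → ℂ :=
    smoothedForm θ (f : (AdelicGroupData.gl n K).L2 μ') with hφt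
  set φt' : (AdelicGroupData.gl n K).automorphicQuotient → ℂ :=
    smoothedForm θ (f' : (AdelicGroupData.gl n K).L2 μ') with hφt'
  set φ : GL (Fin n) (AdeleRing (𝓞 K) K) → ℂ := invQuot (AdelicGroupData.gl n K) φt with hφ
  set φ' : GL (Fin n) (AdeleRing (𝓞 K) K) → ℂ := invQuot (AdelicGroupData.gl n K) φt' with hφ'
  have hφtc : Continuous φt := continuous_smoothedForm hθ hθs _
  have hφt'c : Continuous φt' := continuous_smoothedForm hθ hθs _
  have hφc : Continuous φ := continuous_invQuot_smoothedForm hθ hθs _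
  have hφ'c : Continuous φ' := continuous_invQuot_smoothedForm hθ hθs _
  have hφK : ∀ (γ₀ : GL (Fin n) K) (x : GL (Fin n) (AdeleRing (𝓞 K) K)),
      φ (Matrix.GeneralLinearGroup.map (algebraMap K (AdeleRing (𝓞 K) K)) γ₀ * x) = φ x :=
    fun γ₀ x => isLeftInvariant_invQuot _ φt _ ⟨γ₀, rfl⟩ x
  have hφ'K : ∀ (γ₀ : GL (Fin n) K) (x : GL (Fin n) (AdeleRing (𝓞 K) K)),
      φ' (Matrix.GeneralLinearGroup.map (algebraMap K (AdeleRing (𝓞 K) K)) γ₀ * x) = φ' x :=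
    fun γ₀ x => isLeftInvariant_invQuot _ φt' _ ⟨γ₀, rfl⟩ x
  have hcusp : ∀ k, 0 < k → k < n → CuspConditionGL n K φ k := fun k hk hkn =>
    cuspConditionGL_invQuot_smoothedForm hθ hθs (P.2.1 f.2) hk hkn
  have hcusp' : ∀ k, 0 < k → k < n → CuspConditionGL n K φ' k := fun k hk hkn =>
    cuspConditionGL_invQuot_smoothedForm hθ hθs (P'.2.1 f'.2) hk hkn
  have hΦc : Continuous Φ := by
    have h : Continuous fun x => ((Φ x : ℂ)).re := Complex.continuous_re.comp (continuous_of_mem_piSchwartzBruhat hΦS)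
    simpa only [Complex.ofReal_re] using h
  -- the twisting character
  have hηu : η.IsUnitary := by
    intro a
    rw [hηeq, HeckeCharacter.mul_apply, HeckeCharacter.inv_apply, Units.val_mul, Units.val_inv_eq_inv_val,
      norm_mul, norm_inv, hωu a, hω'u a, inv_one, mul_one]
  -- the Eisenstein weight (real, `[0, ∞]`-valued) and its complex avatar
  set w : GL (Fin n) (AdeleRing (𝓞 K) K) → ℝ≥0∞ := eisensteinWeight n K Φ σ with hw
  have hwm : Measurable w := measurable_eisensteinWeight
    (fun v => (hΦc.comp (continuous_const.matrix_vecMul Units.continuous_val)).measurable) σ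
  set W : GL (Fin n) (AdeleRing (𝓞 K) K) → ℂ := fun x => (((w x).toReal : ℝ) : ℂ) with hW
  have hWm : Measurable W := Complex.measurable_ofReal.comp hwm.ennreal_toReal
  have hWK : ∀ (γ : GL (Fin n) K) (g : GL (Fin n) (AdeleRing (𝓞 K) K)),
      W (Matrix.GeneralLinearGroup.map (algebraMap K (AdeleRing (𝓞 K) K)) γ * g) = W g := by
    intro γ g
    simp only [hW, hw, eisensteinWeight_map_mul Φ σ γ g]
  have hWle : ∀ x, ‖W x‖ₑ ≤ w x := fun x => by
    rw [hW]
    exact enorm_ofReal_wt_le w x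
  -- the descended twisted Eisenstein series is the weighted idele-class integral
  set E : (AdelicGroupData.gl n K).automorphicQuotient → ℂ :=
    mirabolicEisensteinTwistedQuot νI hη₀ (fun x => (Φ x : ℂ)) (σ : ℂ) with hE
  have hσ' : 1 < ((σ : ℂ)).re := by rwa [Complex.ofReal_re]
  have hEc : Continuous E := continuous_mirabolicEisensteinTwistedQuot_of_mem_piSchwartzBruhat νI hηu hη₀ hΦS hσ'
  have hEg : ∀ g : GL (Fin n) (AdeleRing (𝓞 K) K),
      (∫⁻ a in 𝓕, w (Matrix.GeneralLinearGroup.scalar (Fin n) a * g⁻¹) ∂νI) < ⊤ ∧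
      E ((AdelicGroupData.gl n K).toAutomorphicQuotient g) =
        ∫ a in 𝓕, W (Matrix.GeneralLinearGroup.scalar (Fin n) a * g⁻¹) * ((η a : ℂˣ) : ℂ) ∂νI := by
    intro g
    rw [hE, mirabolicEisensteinTwistedQuot_toAutomorphicQuotient]
    exact mirabolicEisensteinTwisted_ofReal_eq_setIntegral_eisensteinWeight νI h𝓕 hηu hΦS hΦ0 hσ g⁻¹
  have hmaj : ∀ g : GL (Fin n) (AdeleRing (𝓞 K) K),
      ∫⁻ a in 𝓕, ‖W (Matrix.GeneralLinearGroup.scalar (Fin n) a * g⁻¹)‖ₑ ∂νI < ⊤ := fun g =>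
    lt_of_le_of_lt (lintegral_mono fun a => hWle _) (hEg g).1
  -- `F = φ̄̃' φ̃` and its central character `η⁻¹ = ω' ω⁻¹`
  set F : (AdelicGroupData.gl n K).automorphicQuotient → ℂ := fun x => (star φt') x * φt x with hF
  have hFm : Measurable F := ((continuous_star.comp hφt'c).mul hφtc).measurable
  have hFZ : ∀ (z : ideleGroup K) (g : GL (Fin n) (AdeleRing (𝓞 K) K)),
      F ((AdelicGroupData.gl n K).toAutomorphicQuotient (Matrix.GeneralLinearGroup.scalar (Fin n) z * g)) =
        ((η z : ℂˣ) : ℂ)⁻¹ * F ((AdelicGroupData.gl n K).toAutomorphicQuotient g) := by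
    intro z g
    have e1 := hωf z g
    have e2 := hω'f' z g
    set x₁ : (AdelicGroupData.gl n K).automorphicQuotient :=
      (AdelicGroupData.gl n K).toAutomorphicQuotient (Matrix.GeneralLinearGroup.scalar (Fin n) z * g) with hx₁
    set x₀ : (AdelicGroupData.gl n K).automorphicQuotient := (AdelicGroupData.gl n K).toAutomorphicQuotient g with hx₀
    have h1 : conj (((ω' z : ℂˣ) : ℂ)) = (((ω' z : ℂˣ) : ℂ))⁻¹ := by
      have hn1 : ‖((ω' z : ℂˣ) : ℂ)‖ = 1 := hω'u z
      rw [Complex.inv_def, Complex.normSq_eq_norm_sq, hn1]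
      simp
    have hz : ((ω z : ℂˣ) : ℂ) ≠ 0 := (ω z).ne_zero
    have hz' : ((ω' z : ℂˣ) : ℂ) ≠ 0 := (ω' z).ne_zero
    have hηz : ((η z : ℂˣ) : ℂ) = ((ω z : ℂˣ) : ℂ) * (((ω' z : ℂˣ) : ℂ))⁻¹ := by
      rw [hηeq, HeckeCharacter.mul_apply, HeckeCharacter.inv_apply, Units.val_mul, Units.val_inv_eq_inv_val]
    simp only [hF, Pi.star_apply, Complex.star_def, e1, e2, map_mul, map_inv₀, h1, inv_inv, hηz]
    field_simp
  -- finiteness of the unfolded majorant `∫ |W φ̄' φ| β dν` (AM–GM and the two one-form identities)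
  have hone₁ := hone hφc hφK hcusp hΦ0 hΦm σ hβG.1 hβG.2
  have hone₂ := hone hφ'c hφ'K hcusp' hΦ0 hΦm σ hβG.1 hβG.2
  have hfinG₁ : ∫⁻ x, ENNReal.ofReal (‖φ x‖ ^ 2) * w x * βG x ∂ν ≠ ⊤ := by
    rw [← hone₁]; exact ENNReal.mul_ne_top hC₃t hfin
  have hfinG₂ : ∫⁻ x, ENNReal.ofReal (‖φ' x‖ ^ 2) * w x * βG x ∂ν ≠ ⊤ := by
    rw [← hone₂]; exact ENNReal.mul_ne_top hC₃t hfin'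
  have hint : ∫⁻ g, ‖W g * F ((AdelicGroupData.gl n K).toAutomorphicQuotient g⁻¹)‖ₑ * βG g ∂ν < ⊤ := by
    have hle : ∀ g : GL (Fin n) (AdeleRing (𝓞 K) K), ‖W g * F ((AdelicGroupData.gl n K).toAutomorphicQuotient g⁻¹)‖ₑ * βG g ≤
        ENNReal.ofReal (‖φ g‖ ^ 2) * w g * βG g + ENNReal.ofReal (‖φ' g‖ ^ 2) * w g * βG g := by
      intro g
      have hF' : ‖F ((AdelicGroupData.gl n K).toAutomorphicQuotient g⁻¹)‖ₑ = ‖φ' g‖ₑ * ‖φ g‖ₑ := by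
        simp only [hF, hφ, hφ', invQuot_apply, Pi.star_apply, Complex.star_def, enorm_mul]
        congr 1
        rw [← ofReal_norm, Complex.norm_conj, ofReal_norm]
      have hsq : ‖φ' g‖ₑ * ‖φ g‖ₑ ≤ ENNReal.ofReal (‖φ g‖ ^ 2) + ENNReal.ofReal (‖φ' g‖ ^ 2) := by
        rw [← ofReal_norm, ← ofReal_norm, ← ENNReal.ofReal_mul (norm_nonneg _),
          ← ENNReal.ofReal_add (sq_nonneg _) (sq_nonneg _)]
        refine ENNReal.ofReal_le_ofReal ?_
        nlinarith [sq_nonneg (‖φ g‖ - ‖φ' g‖), norm_nonneg (φ g), norm_nonneg (φ' g)]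
      calc ‖W g * F ((AdelicGroupData.gl n K).toAutomorphicQuotient g⁻¹)‖ₑ * βG g
          = ‖W g‖ₑ * (‖φ' g‖ₑ * ‖φ g‖ₑ) * βG g := by rw [enorm_mul, hF']
        _ ≤ w g * (ENNReal.ofReal (‖φ g‖ ^ 2) + ENNReal.ofReal (‖φ' g‖ ^ 2)) * βG g := by
          gcongr
          exact hWle g
        _ = _ := by ring
    calc ∫⁻ g, ‖W g * F ((AdelicGroupData.gl n K).toAutomorphicQuotient g⁻¹)‖ₑ * βG g ∂ν
        ≤ ∫⁻ g, ENNReal.ofReal (‖φ g‖ ^ 2) * w g * βG g + ENNReal.ofReal (‖φ' g‖ ^ 2) * w g * βG g ∂ν :=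
          lintegral_mono hle
      _ = (∫⁻ g, ENNReal.ofReal (‖φ g‖ ^ 2) * w g * βG g ∂ν) + ∫⁻ g, ENNReal.ofReal (‖φ' g‖ ^ 2) * w g * βG g ∂ν := by
          refine lintegral_add_left ?_ _
          exact ((ENNReal.measurable_ofReal.comp (hφc.norm.pow 2).measurable).mul hwm).mul hβG.1
      _ < ⊤ := ENNReal.add_lt_top.2 ⟨lt_top_iff_ne_top.2 hfinG₁, lt_top_iff_ne_top.2 hfinG₂⟩
  -- Step 1: the twisted Rankin–Selberg integral is `∫_X E F dμ'`
  have hRS : rankinSelbergIntegralTwisted μ' νI hη₀ (fun x => (Φ x : ℂ)) (σ : ℂ) (star φt') φt = ∫ x, E x * F x ∂μ' := by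
    unfold rankinSelbergIntegralTwisted
    refine integral_congr_ae (ae_of_all _ fun x => ?_)
    simp only [hF, hE]
    ring
  -- Step 2: unfold on the quotient
  have h5' := h5 h𝓕 hηu hη₀ hWm hWK hmaj hFm hFZ hEc.measurable (fun g => (hEg g).2) hβG.1 hβG.2 hint
  -- Step 3: unfold to the torus (the group-side integrals agree)
  have hpair' := hpair hφc hφ'c hφK hφ'K hcusp hcusp' hΦ0 hΦm σ hwm hβG.1 hβG.2 hfinG₁ hfinG₂
  have hG : (∫ g : (AdelicGroupData.gl n K).Adelic,
      W g * (wt βG g : ℂ) * F ((AdelicGroupData.gl n K).toAutomorphicQuotient g⁻¹)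
        ∂(show Measure (AdelicGroupData.gl n K).Adelic from ν)) =
      ∫ x, φ x * conj (φ' x) * (((w x * βG x).toReal : ℝ) : ℂ) ∂ν := by
    show (∫ x : GL (Fin n) (AdeleRing (𝓞 K) K),
      W x * (wt βG x : ℂ) * F ((AdelicGroupData.gl n K).toAutomorphicQuotient x⁻¹) ∂ν) = _
    refine integral_congr_ae (ae_of_all _ fun g => ?_)
    simp only [hF, hW, hφ, hφ', invQuot_apply, Pi.star_apply, Complex.star_def, wt, ENNReal.toReal_mul,
      Complex.ofReal_mul]
    ring
  rw [hRS, h5', hG, ← hpair']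
  push_cast
  ring

end Pairs

end Literature.NumberTheory.Automorphic
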